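import Summits.QuantumFields.BalabanUV.T4Continuum.Support.VariationalVectorFederbushLine
import Summits.QuantumFields.BalabanUV.T4Continuum.Support.VariationalVectorAverage
import Summits.QuantumFields.BalabanUV.T4Continuum.Support.VariationalVectorWeitzenbock

/-!
# T⁴ programme, spine node NE2 (U1a), lane P2 — toward (GF3) WITH BACKGROUND, file 4: FLAT-VERSUS-BACKGROUND PERTURBATION BOUNDS IN A REGULAR SMALL GAUGE
# (`‖R − 1‖ ≤ a`, contractive `R`): divergence `nsqv (div_R W − div_1 W) ≤ d·a²·nsqV W`, curl `curlSq_1 W ≤ 2·curlSq_R W + 8d·a²·nsqV W` (and back),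
# line average `nsqV (Q_1 W − Q_{lineT 1 R} W) ≤ (n·a)²·qWV W` — the three `O(α²)` error terms of the (GF3) transfer (model level, general Hilbert `E`)

NE2 formalisation swarm `b2b-balaban-t4-ne2-formalise-*`, leaf prover 03 GEN 6 (`prover-b2b-balaban-t4-ne2-formalise-leaf-03-g6-0`); journal INTENT
CLAIMS.log l.18308 «(GF3) WITH BACKGROUND IN THE REGULAR GAUGE».  On top of leaf-01-g5's `VariationalVectorFederbushLine.lineT` ∕ `VariationalColourFederbush.piTv`,
`VariationalVectorAverage.nsqV_QvL_le_qWV` (V-AVG), `VariationalVectorWeitzenbock.{divV, divSq}`, `VariationalVectorForm.{curlV, curlSq, qWV}` — BY NAME.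

CONTENTS ([folklore]; `α := n·a`).
 * §1 `divV_sub_flat_apply`, **`nsqv_divV_sub_flat_le`** (`Σ_x‖div_R W x − div_1 W x‖² ≤ d·a²·nsqV W`), **`divSq_flat_le`** ∕ **`divSq_le_flat`** (`divSq_1 ≤ 2divSq_R + 2da²·nsqV`,
   `divSq_R ≤ 2divSq_1 + 2da²·nsqV`);
 * §2 `curlV_sub_flat_apply`, **`curlSq_flat_le`** (`curlSq_1 W ≤ 2·curlSq_R W + 8d·a²·nsqV W`);
 * §3 `norm_piTv_sub_one_le` (`‖Π_t − 1‖ ≤ t·a`), `QvL_sub_transport`, `nsqV_QvL_le_of_norm_le` (`‖T‖ ≤ c ⟹ nsqV (Q_T W) ≤ c²·qWV W`),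
   **`nsqV_QvL_flat_sub_line_le`** (`nsqV (Q_1 W − Q_{lineT 1 R} W) ≤ (n·a)²·qWV W`), **`nsqV_QvL_flat_le`** (`nsqV (Q_1 W) ≤ 2·nsqV (Q_{lineT 1 R} W) + 2(na)²·qWV W`).

HONEST FRAMING (T4-DAG p. 1).  Elementary lattice bookkeeping about OUR typed objects (c5); nothing printed is a hypothesis; no `def`, no `sorry`; axioms standard.
(GF3) with background is assembled in file 5 (`ProjGDivControlRegular`); NE2 NOT proved; spine PROVED 0∕9; NOT infinite volume ∕ mass gap ∕ Clay.  HONEST DEPENDENCY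
(cell, verbatim): continuum YM on T⁴ ⇐ BetaPertH ∧ nine spine estimates (0/9 proved); BetaPertH ⇐ (D1) ∧ (D4) ∧ CAP+tail; G-an2-4 gates asym, D1 and NE2/3/4.
-/

noncomputable section

namespace Summit.QuantumFields.BalabanUV.T4Continuum.RegularGaugePerturbation

open Finset
open scoped BigOperators
open Literature.MathematicalPhysics.QuantumFieldTheory.Balaban1983to89.B5Prop11Plancherel (Tor fine unitVec)
open Literature.MathematicalPhysics.QuantumFieldTheory.Balaban1983to89.B5Block118 (bpt tstep)
open Summit.QuantumFields.BalabanUV.T4Continuum.VariationalColourFederbush (piTv norm_piTv_le_one)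
open Summit.QuantumFields.BalabanUV.T4Continuum.VariationalColourBochner (nsqv nsqv_nonneg sum_sq_translate)
open Summit.QuantumFields.BalabanUV.T4Continuum.VariationalVectorWeitzenbock (divV divSq divV_apply nsqV_eq_sum_nsqv)
open Summit.QuantumFields.BalabanUV.T4Continuum.VariationalVectorForm (curlV curlSq cdV qWV)
open Summit.QuantumFields.BalabanUV.T4Continuum.VectorBlockTrialForm (nsqV nsqV_nonneg QvL)
open Summit.QuantumFields.BalabanUV.T4Continuum.VariationalVectorFederbush (lineT)
open Summit.QuantumFields.BalabanUV.T4Continuum.VariationalVectorAverage (nsqV_QvL_le_qWV)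

variable {d : ℕ}
variable {E : Type*} [NormedAddCommGroup E] [InnerProductSpace ℂ E] [CompleteSpace E]

/-! ## §1 The divergence -/

section Div

variable (N : Fin d → ℕ) [∀ μ, NeZero (N μ)]


omit [∀ μ, NeZero (N μ)] in
/-- `div_R W (x) − div_1 W (x) = Σ_μ (R(x−e_μ,μ)⋆ − 1)(W(x−e_μ,μ))`. [folklore] -/
theorem divV_sub_flat_apply (R : Tor N → Fin d → (E →L[ℂ] E)) (W : Tor N → Fin d → E) (x : Tor N) :
    divV N R W x - divV N (fun (_ : Tor N) (_ : Fin d) => (1 : E →L[ℂ] E)) W x = ∑ μ, (star (R (x - unitVec N μ) μ) - 1) (W (x - unitVec N μ) μ) := by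
  rw [divV_apply, divV_apply, ← sum_sub_distrib]
  refine sum_congr rfl fun μ _ => ?_
  simp only [star_one, one_apply_eq_self, sub_apply]
  abel

/-- **`Σ_x ‖div_R W x − div_1 W x‖² ≤ d·a²·nsqV W`** for `‖R − 1‖ ≤ a`. [folklore] -/
theorem nsqv_divV_sub_flat_le {R : Tor N → Fin d → (E →L[ℂ] E)} {a : ℝ} (ha : ∀ x μ, ‖R x μ - 1‖ ≤ a) (W : Tor N → Fin d → E) :
    nsqv N (divV N R W - divV N (fun (_ : Tor N) (_ : Fin d) => (1 : E →L[ℂ] E)) W) ≤ d * a ^ 2 * nsqV N W := by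
  have hd : (Fintype.card (Fin d) : ℝ) = d := by rw [Fintype.card_fin]
  have hpt : ∀ x, ‖(divV N R W - divV N (fun (_ : Tor N) (_ : Fin d) => (1 : E →L[ℂ] E)) W) x‖ ^ 2 ≤ d * ∑ μ, a ^ 2 * ‖W (x - unitVec N μ) μ‖ ^ 2 := by
    intro x
    have h1 : ‖(divV N R W - divV N (fun (_ : Tor N) (_ : Fin d) => (1 : E →L[ℂ] E)) W) x‖ ≤ ∑ μ, a * ‖W (x - unitVec N μ) μ‖ := by
      rw [Pi.sub_apply, divV_sub_flat_apply]
      refine (norm_sum_le _ _).trans (sum_le_sum fun μ _ => ?_)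
      have hn : ‖star (R (x - unitVec N μ) μ) - 1‖ ≤ a := by
        rw [← star_one (R := E →L[ℂ] E), ← star_sub, norm_star]; exact ha _ μ
      exact (ContinuousLinearMap.le_opNorm _ _).trans (mul_le_mul_of_nonneg_right hn (norm_nonneg _))
    have h2 := sq_sum_le_card_mul_sum_sq (s := Finset.univ) (f := fun μ : Fin d => a * ‖W (x - unitVec N μ) μ‖)
    rw [Finset.card_univ, hd] at h2
    calc ‖(divV N R W - divV N (fun (_ : Tor N) (_ : Fin d) => (1 : E →L[ℂ] E)) W) x‖ ^ 2 ≤ (∑ μ, a * ‖W (x - unitVec N μ) μ‖) ^ 2 := pow_le_pow_left₀ (norm_nonneg _) h1 2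
      _ ≤ _ := h2.trans (le_of_eq (by congr 1; exact sum_congr rfl fun μ _ => by ring))
  unfold nsqv
  calc ∑ x, ‖(divV N R W - divV N (fun (_ : Tor N) (_ : Fin d) => (1 : E →L[ℂ] E)) W) x‖ ^ 2 ≤ ∑ x, (d * ∑ μ, a ^ 2 * ‖W (x - unitVec N μ) μ‖ ^ 2) := sum_le_sum fun x _ => hpt x
    _ = d * a ^ 2 * ∑ μ, ∑ x, ‖W (x - unitVec N μ) μ‖ ^ 2 := by rw [← mul_sum, Finset.sum_comm]; simp only [← mul_sum]; ring
    _ = d * a ^ 2 * nsqV N W := by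
        rw [nsqV_eq_sum_nsqv]
        congr 1
        refine sum_congr rfl fun μ _ => ?_
        have := sum_sq_translate N (fun y => W y μ) (-unitVec N μ)
        simp only [← sub_eq_add_neg] at this
        exact this

/-- `divSq_1 W ≤ 2·divSq_R W + 2d·a²·nsqV W`. [folklore] -/
theorem divSq_flat_le {R : Tor N → Fin d → (E →L[ℂ] E)} {a : ℝ} (ha : ∀ x μ, ‖R x μ - 1‖ ≤ a) (W : Tor N → Fin d → E) :
    divSq N (fun (_ : Tor N) (_ : Fin d) => (1 : E →L[ℂ] E)) W ≤ 2 * divSq N R W + 2 * d * a ^ 2 * nsqV N W := by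
  have h := nsqv_divV_sub_flat_le N ha W
  unfold nsqv at h
  unfold divSq
  have hpt : ∀ x, ‖divV N (fun (_ : Tor N) (_ : Fin d) => (1 : E →L[ℂ] E)) W x‖ ^ 2 ≤ 2 * ‖divV N R W x‖ ^ 2 + 2 * ‖(divV N R W - divV N (fun (_ : Tor N) (_ : Fin d) => (1 : E →L[ℂ] E)) W) x‖ ^ 2 := by
    intro x
    have e : divV N (fun (_ : Tor N) (_ : Fin d) => (1 : E →L[ℂ] E)) W x = divV N R W x - (divV N R W - divV N (fun (_ : Tor N) (_ : Fin d) => (1 : E →L[ℂ] E)) W) x := by rw [Pi.sub_apply, sub_sub_cancel]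
    rw [e]
    have h1 : ‖divV N R W x - (divV N R W - divV N (fun (_ : Tor N) (_ : Fin d) => (1 : E →L[ℂ] E)) W) x‖ ^ 2 ≤ (‖divV N R W x‖ + ‖(divV N R W - divV N (fun (_ : Tor N) (_ : Fin d) => (1 : E →L[ℂ] E)) W) x‖) ^ 2 :=
      pow_le_pow_left₀ (norm_nonneg _) (norm_sub_le _ _) 2
    nlinarith [h1, sq_nonneg (‖divV N R W x‖ - ‖(divV N R W - divV N (fun (_ : Tor N) (_ : Fin d) => (1 : E →L[ℂ] E)) W) x‖)]
  calc ∑ x, ‖divV N (fun (_ : Tor N) (_ : Fin d) => (1 : E →L[ℂ] E)) W x‖ ^ 2 ≤ ∑ x, (2 * ‖divV N R W x‖ ^ 2 + 2 * ‖(divV N R W - divV N (fun (_ : Tor N) (_ : Fin d) => (1 : E →L[ℂ] E)) W) x‖ ^ 2) := sum_le_sum fun x _ => hpt x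
    _ = 2 * ∑ x, ‖divV N R W x‖ ^ 2 + 2 * ∑ x, ‖(divV N R W - divV N (fun (_ : Tor N) (_ : Fin d) => (1 : E →L[ℂ] E)) W) x‖ ^ 2 := by rw [sum_add_distrib, ← mul_sum, ← mul_sum]
    _ ≤ _ := by nlinarith [h]

/-- `divSq_R W ≤ 2·divSq_1 W + 2d·a²·nsqV W`. [folklore] -/
theorem divSq_le_flat {R : Tor N → Fin d → (E →L[ℂ] E)} {a : ℝ} (ha : ∀ x μ, ‖R x μ - 1‖ ≤ a) (W : Tor N → Fin d → E) :
    divSq N R W ≤ 2 * divSq N (fun (_ : Tor N) (_ : Fin d) => (1 : E →L[ℂ] E)) W + 2 * d * a ^ 2 * nsqV N W := by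
  have h := nsqv_divV_sub_flat_le N ha W
  unfold nsqv at h
  unfold divSq
  have hpt : ∀ x, ‖divV N R W x‖ ^ 2 ≤ 2 * ‖divV N (fun (_ : Tor N) (_ : Fin d) => (1 : E →L[ℂ] E)) W x‖ ^ 2 + 2 * ‖(divV N R W - divV N (fun (_ : Tor N) (_ : Fin d) => (1 : E →L[ℂ] E)) W) x‖ ^ 2 := by
    intro x
    have e : divV N R W x = divV N (fun (_ : Tor N) (_ : Fin d) => (1 : E →L[ℂ] E)) W x + (divV N R W - divV N (fun (_ : Tor N) (_ : Fin d) => (1 : E →L[ℂ] E)) W) x := by rw [Pi.sub_apply, add_sub_cancel]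
    rw [e]
    have h1 : ‖divV N (fun (_ : Tor N) (_ : Fin d) => (1 : E →L[ℂ] E)) W x + (divV N R W - divV N (fun (_ : Tor N) (_ : Fin d) => (1 : E →L[ℂ] E)) W) x‖ ^ 2 ≤ (‖divV N (fun (_ : Tor N) (_ : Fin d) => (1 : E →L[ℂ] E)) W x‖ + ‖(divV N R W - divV N (fun (_ : Tor N) (_ : Fin d) => (1 : E →L[ℂ] E)) W) x‖) ^ 2 :=
      pow_le_pow_left₀ (norm_nonneg _) (norm_add_le _ _) 2
    nlinarith [h1, sq_nonneg (‖divV N (fun (_ : Tor N) (_ : Fin d) => (1 : E →L[ℂ] E)) W x‖ - ‖(divV N R W - divV N (fun (_ : Tor N) (_ : Fin d) => (1 : E →L[ℂ] E)) W) x‖)]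
  calc ∑ x, ‖divV N R W x‖ ^ 2 ≤ ∑ x, (2 * ‖divV N (fun (_ : Tor N) (_ : Fin d) => (1 : E →L[ℂ] E)) W x‖ ^ 2 + 2 * ‖(divV N R W - divV N (fun (_ : Tor N) (_ : Fin d) => (1 : E →L[ℂ] E)) W) x‖ ^ 2) := sum_le_sum fun x _ => hpt x
    _ = 2 * ∑ x, ‖divV N (fun (_ : Tor N) (_ : Fin d) => (1 : E →L[ℂ] E)) W x‖ ^ 2 + 2 * ∑ x, ‖(divV N R W - divV N (fun (_ : Tor N) (_ : Fin d) => (1 : E →L[ℂ] E)) W) x‖ ^ 2 := by rw [sum_add_distrib, ← mul_sum, ← mul_sum]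
    _ ≤ _ := by nlinarith [h]

end Div

/-! ## §2 The curl -/

section Curl

variable (N : Fin d → ℕ) [∀ μ, NeZero (N μ)]


omit [∀ μ, NeZero (N μ)] [InnerProductSpace ℂ E] [CompleteSpace E] in
/-- `curl_1 W − curl_R W = (1 − R(x,μ))W(x+e_μ,ν) − (1 − R(x,ν))W(x+e_ν,μ)`. [folklore] -/
theorem curlV_flat_sub_apply [NormedSpace ℂ E] (R : Tor N → Fin d → (E →L[ℂ] E)) (W : Tor N → Fin d → E) (x : Tor N) (μ ν : Fin d) :
    curlV N (fun (_ : Tor N) (_ : Fin d) => (1 : E →L[ℂ] E)) W x μ ν - curlV N R W x μ ν = (1 - R x μ) (W (x + unitVec N μ) ν) - (1 - R x ν) (W (x + unitVec N ν) μ) := by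
  simp only [curlV, cdV, sub_apply, one_apply_eq_self]
  abel

omit [CompleteSpace E] in
/-- **`curlSq_1 W ≤ 2·curlSq_R W + 8d·a²·nsqV W`** for `‖R − 1‖ ≤ a`. [folklore] -/
theorem curlSq_flat_le {R : Tor N → Fin d → (E →L[ℂ] E)} {a : ℝ} (ha : ∀ x μ, ‖R x μ - 1‖ ≤ a) (W : Tor N → Fin d → E) :
    curlSq N (fun (_ : Tor N) (_ : Fin d) => (1 : E →L[ℂ] E)) W ≤ 2 * curlSq N R W + 8 * d * a ^ 2 * nsqV N W := by
  have hpt : ∀ x μ ν, ‖curlV N (fun (_ : Tor N) (_ : Fin d) => (1 : E →L[ℂ] E)) W x μ ν‖ ^ 2 ≤ 2 * ‖curlV N R W x μ ν‖ ^ 2 + 4 * a ^ 2 * (‖W (x + unitVec N μ) ν‖ ^ 2 + ‖W (x + unitVec N ν) μ‖ ^ 2) := by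
    intro x μ ν
    have hdiff : ‖curlV N (fun (_ : Tor N) (_ : Fin d) => (1 : E →L[ℂ] E)) W x μ ν - curlV N R W x μ ν‖ ≤ a * ‖W (x + unitVec N μ) ν‖ + a * ‖W (x + unitVec N ν) μ‖ := by
      rw [curlV_flat_sub_apply]
      have n1 : ∀ κ, ‖(1 : E →L[ℂ] E) - R x κ‖ ≤ a := fun κ => by rw [norm_sub_rev]; exact ha x κ
      exact (norm_sub_le _ _).trans (add_le_add ((ContinuousLinearMap.le_opNorm _ _).trans (mul_le_mul_of_nonneg_right (n1 μ) (norm_nonneg _)))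
        ((ContinuousLinearMap.le_opNorm _ _).trans (mul_le_mul_of_nonneg_right (n1 ν) (norm_nonneg _))))
    have e : curlV N (fun (_ : Tor N) (_ : Fin d) => (1 : E →L[ℂ] E)) W x μ ν = curlV N R W x μ ν + (curlV N (fun (_ : Tor N) (_ : Fin d) => (1 : E →L[ℂ] E)) W x μ ν - curlV N R W x μ ν) := (add_sub_cancel _ _).symm
    have h1 : ‖curlV N (fun (_ : Tor N) (_ : Fin d) => (1 : E →L[ℂ] E)) W x μ ν‖ ≤ ‖curlV N R W x μ ν‖ + (a * ‖W (x + unitVec N μ) ν‖ + a * ‖W (x + unitVec N ν) μ‖) := by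
      rw [e]; exact (norm_add_le _ _).trans (add_le_add le_rfl hdiff)
    have h0 : 0 ≤ ‖curlV N (fun (_ : Tor N) (_ : Fin d) => (1 : E →L[ℂ] E)) W x μ ν‖ := norm_nonneg _
    nlinarith [h1, norm_nonneg (curlV N R W x μ ν), sq_nonneg (‖curlV N R W x μ ν‖ - (a * ‖W (x + unitVec N μ) ν‖ + a * ‖W (x + unitVec N ν) μ‖)),
      sq_nonneg (a * ‖W (x + unitVec N μ) ν‖ - a * ‖W (x + unitVec N ν) μ‖)]
  have hshift : ∀ μ ν : Fin d, ∑ x, ‖W (x + unitVec N μ) ν‖ ^ 2 = ∑ x, ‖W x ν‖ ^ 2 := fun μ ν => sum_sq_translate N (fun y => W y ν) (unitVec N μ)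
  have pull : ∀ (c : ℝ) (f : Tor N → Fin d → Fin d → ℝ), ∑ x, ∑ μ, ∑ ν, c * f x μ ν = c * ∑ x, ∑ μ, ∑ ν, f x μ ν := by
    intro c f; simp only [Finset.mul_sum]
  have e1 : ∑ x, ∑ μ : Fin d, ∑ ν, ‖W (x + unitVec N μ) ν‖ ^ 2 = d * nsqV N W := by
    rw [Finset.sum_comm]
    have : ∀ μ : Fin d, ∑ x, ∑ ν, ‖W (x + unitVec N μ) ν‖ ^ 2 = nsqV N W := fun μ => by
      rw [Finset.sum_comm, nsqV_eq_sum_nsqv]; exact sum_congr rfl fun ν _ => hshift μ ν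
    simp only [this, sum_const, card_univ, Fintype.card_fin, nsmul_eq_mul]
  have e2 : ∑ x, ∑ μ : Fin d, ∑ ν : Fin d, ‖W (x + unitVec N ν) μ‖ ^ 2 = d * nsqV N W := by
    rw [Finset.sum_comm]
    have : ∀ μ : Fin d, ∑ x, ∑ ν : Fin d, ‖W (x + unitVec N ν) μ‖ ^ 2 = d * ∑ x, ‖W x μ‖ ^ 2 := fun μ => by
      rw [Finset.sum_comm]
      have : ∀ ν : Fin d, ∑ x, ‖W (x + unitVec N ν) μ‖ ^ 2 = ∑ x, ‖W x μ‖ ^ 2 := fun ν => sum_sq_translate N (fun y => W y μ) (unitVec N ν)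
      simp only [this, sum_const, card_univ, Fintype.card_fin, nsmul_eq_mul]
    simp only [this, ← mul_sum, nsqV_eq_sum_nsqv]
  unfold curlSq
  calc ∑ x, ∑ μ, ∑ ν, ‖curlV N (fun (_ : Tor N) (_ : Fin d) => (1 : E →L[ℂ] E)) W x μ ν‖ ^ 2
      ≤ ∑ x, ∑ μ, ∑ ν, (2 * ‖curlV N R W x μ ν‖ ^ 2 + (4 * a ^ 2) * ‖W (x + unitVec N μ) ν‖ ^ 2 + (4 * a ^ 2) * ‖W (x + unitVec N ν) μ‖ ^ 2) :=
        sum_le_sum fun x _ => sum_le_sum fun μ _ => sum_le_sum fun ν _ => (hpt x μ ν).trans (le_of_eq (by ring))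
    _ = 2 * ∑ x, ∑ μ, ∑ ν, ‖curlV N R W x μ ν‖ ^ 2 + (4 * a ^ 2) * ∑ x, ∑ μ, ∑ ν, ‖W (x + unitVec N μ) ν‖ ^ 2
          + (4 * a ^ 2) * ∑ x, ∑ μ, ∑ ν, ‖W (x + unitVec N ν) μ‖ ^ 2 := by
        rw [← pull, ← pull, ← pull]; simp only [← sum_add_distrib]
    _ = _ := by rw [e1, e2]; ring

end Curl


/-! ## §3 The line average: flat transports versus the product line transports `lineT 1 R` -/

section Average

variable (n : ℕ) [NeZero n] (M : Fin d → ℕ) [hM : ∀ μ, NeZero (M μ)]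

omit [InnerProductSpace ℂ E] [CompleteSpace E] [NeZero n] hM in
/-- `‖Π_t − 1‖ ≤ t·a` for contractive transports within `a` of the identity. [folklore] -/
theorem norm_piTv_sub_one_le [NormedSpace ℂ E] {R : Tor (fine n M) → Fin d → (E →L[ℂ] E)} (hR1 : ∀ x μ, ‖R x μ‖ ≤ 1) {a : ℝ}
    (ha : ∀ x μ, ‖R x μ - 1‖ ≤ a) (x : Tor (fine n M)) (μ : Fin d) (t : ℕ) : ‖piTv n M R x μ t - 1‖ ≤ t * a := by
  induction t with
  | zero => simp [piTv]
  | succ t ih =>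
    have ha0 : 0 ≤ a := (norm_nonneg _).trans (ha x μ)
    simp only [piTv]
    calc ‖piTv n M R x μ t * R (x + tstep (fine n M) μ t) μ - 1‖
        = ‖(piTv n M R x μ t - 1) * R (x + tstep (fine n M) μ t) μ + (R (x + tstep (fine n M) μ t) μ - 1)‖ := by
          congr 1; rw [sub_mul, one_mul]; abel
      _ ≤ ‖piTv n M R x μ t - 1‖ * ‖R (x + tstep (fine n M) μ t) μ‖ + ‖R (x + tstep (fine n M) μ t) μ - 1‖ :=
          (norm_add_le _ _).trans (add_le_add (norm_mul_le _ _) le_rfl)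
      _ ≤ t * a * 1 + a := add_le_add (mul_le_mul ih (hR1 _ _) (norm_nonneg _) (by positivity)) (ha _ _)
      _ = ((t + 1 : ℕ) : ℝ) * a := by push_cast; ring

omit [InnerProductSpace ℂ E] [CompleteSpace E] [NeZero n] hM in
/-- the line average is linear in the transports: `Q_T W − Q_{T′} W = Q_{T − T′} W`. [folklore] -/
theorem QvL_sub_transport [NormedSpace ℂ E] (T T' : Tor M → (Fin d → Fin n) → Fin n → Fin d → (E →L[ℂ] E)) (W : Tor (fine n M) → Fin d → E) :
    QvL n M T W - QvL n M T' W = QvL n M (T - T') W := by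
  funext y μ
  simp only [QvL, Pi.sub_apply, sub_apply, sum_sub_distrib, smul_sub]

omit [InnerProductSpace ℂ E] [CompleteSpace E] [NeZero n] hM in
/-- … and homogeneous: `Q_{c•T} W = c • Q_T W`. [folklore] -/
theorem QvL_smul_transport [NormedSpace ℂ E] (c : ℂ) (T : Tor M → (Fin d → Fin n) → Fin n → Fin d → (E →L[ℂ] E)) (W : Tor (fine n M) → Fin d → E) :
    QvL n M (c • T) W = c • QvL n M T W := by
  funext y μ
  simp only [QvL, Pi.smul_apply, smul_apply, ← smul_sum, smul_comm c]

omit [InnerProductSpace ℂ E] [CompleteSpace E] in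
/-- `nsqV (c • φ) = ‖c‖²·nsqV φ`. [folklore] -/
theorem nsqV_smul [NormedSpace ℂ E] (c : ℂ) (φ : Tor M → Fin d → E) : nsqV M (c • φ) = ‖c‖ ^ 2 * nsqV M φ := by
  unfold nsqV
  simp only [Pi.smul_apply, norm_smul, mul_pow, mul_sum]

omit [InnerProductSpace ℂ E] [CompleteSpace E] in
/-- `nsqV (φ + ψ) ≤ 2·nsqV φ + 2·nsqV ψ`. [folklore] -/
theorem nsqV_add_le (φ ψ : Tor M → Fin d → E) : nsqV M (φ + ψ) ≤ 2 * nsqV M φ + 2 * nsqV M ψ := by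
  unfold nsqV
  rw [mul_sum, mul_sum, ← sum_add_distrib]
  refine sum_le_sum fun y _ => ?_
  rw [mul_sum, mul_sum, ← sum_add_distrib]
  refine sum_le_sum fun μ _ => ?_
  have h1 : ‖(φ + ψ) y μ‖ ^ 2 ≤ (‖φ y μ‖ + ‖ψ y μ‖) ^ 2 := pow_le_pow_left₀ (norm_nonneg _) (norm_add_le _ _) 2
  nlinarith [h1, sq_nonneg (‖φ y μ‖ - ‖ψ y μ‖)]

/-- V-AVG scaled: `‖T‖ ≤ c` (pointwise, `0 ≤ c`) ⟹ `nsqV (Q_T W) ≤ c²·qWV W`. [folklore] -/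
theorem nsqV_QvL_le_of_norm_le {T : Tor M → (Fin d → Fin n) → Fin n → Fin d → (E →L[ℂ] E)} {c : ℝ} (hc : 0 ≤ c) (hT : ∀ y j t μ, ‖T y j t μ‖ ≤ c)
    (W : Tor (fine n M) → Fin d → E) : nsqV M (QvL n M T W) ≤ c ^ 2 * qWV n M W := by
  rcases hc.eq_or_lt with hc0 | hcpos
  · have hT0 : T = 0 := by
      funext y j t μ; exact norm_le_zero_iff.mp (by rw [← hc0] at hT; exact hT y j t μ)
    have hQ : QvL n M T W = 0 := by funext y μ; simp [QvL, hT0]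
    rw [hQ, ← hc0]
    unfold nsqV; simp
  · -- rescale: `T = c • T₀` with `‖T₀‖ ≤ 1`
    have hT₀1 : ∀ y j t μ, ‖((((c⁻¹ : ℝ) : ℂ) • T) y j t μ)‖ ≤ 1 := by
      intro y j t μ
      rw [Pi.smul_apply, Pi.smul_apply, Pi.smul_apply, Pi.smul_apply, norm_smul, Complex.norm_real, Real.norm_of_nonneg (inv_nonneg.mpr hc),
        inv_mul_le_iff₀ hcpos, mul_one]
      exact hT y j t μ
    have hTc : T = (c : ℂ) • (((c⁻¹ : ℝ) : ℂ) • T) := by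
      rw [smul_smul, ← Complex.ofReal_mul, mul_inv_cancel₀ hcpos.ne', Complex.ofReal_one, one_smul]
    have key : QvL n M T W = (c : ℂ) • QvL n M (((c⁻¹ : ℝ) : ℂ) • T) W := by
      conv_lhs => rw [hTc]
      exact QvL_smul_transport n M (c : ℂ) _ W
    rw [key, nsqV_smul, Complex.norm_real, Real.norm_of_nonneg hc]
    exact mul_le_mul_of_nonneg_left (nsqV_QvL_le_qWV n M hT₀1 W) (sq_nonneg c)

/-- **`nsqV (Q_1 W − Q_{lineT 1 R} W) ≤ (n·a)²·qWV W`** for contractive `R` with `‖R − 1‖ ≤ a`. [folklore] -/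
theorem nsqV_QvL_flat_sub_line_le {R : Tor (fine n M) → Fin d → (E →L[ℂ] E)} (hR1 : ∀ x μ, ‖R x μ‖ ≤ 1) {a : ℝ} (ha0 : 0 ≤ a)
    (ha : ∀ x μ, ‖R x μ - 1‖ ≤ a) (W : Tor (fine n M) → Fin d → E) :
    nsqV M (QvL n M (fun _ _ _ _ => (1 : E →L[ℂ] E)) W - QvL n M (lineT n M (fun _ => (1 : E →L[ℂ] E)) R) W) ≤ ((n : ℝ) * a) ^ 2 * qWV n M W := by
  rw [QvL_sub_transport]
  refine nsqV_QvL_le_of_norm_le n M (by positivity) (fun y j t μ => ?_) W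
  rw [Pi.sub_apply, Pi.sub_apply, Pi.sub_apply, Pi.sub_apply, lineT, one_mul, norm_sub_rev]
  calc ‖piTv n M R (bpt n M y j) μ t - 1‖ ≤ (t : ℕ) * a := norm_piTv_sub_one_le n M hR1 ha _ μ t
    _ ≤ n * a := mul_le_mul_of_nonneg_right (by exact_mod_cast t.is_lt.le) ha0

/-- **`nsqV (Q_1 W) ≤ 2·nsqV (Q_{lineT 1 R} W) + 2(n·a)²·qWV W`**. [folklore] -/
theorem nsqV_QvL_flat_le {R : Tor (fine n M) → Fin d → (E →L[ℂ] E)} (hR1 : ∀ x μ, ‖R x μ‖ ≤ 1) {a : ℝ} (ha0 : 0 ≤ a)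
    (ha : ∀ x μ, ‖R x μ - 1‖ ≤ a) (W : Tor (fine n M) → Fin d → E) :
    nsqV M (QvL n M (fun _ _ _ _ => (1 : E →L[ℂ] E)) W)
      ≤ 2 * nsqV M (QvL n M (lineT n M (fun _ => (1 : E →L[ℂ] E)) R) W) + 2 * ((n : ℝ) * a) ^ 2 * qWV n M W := by
  have h := nsqV_QvL_flat_sub_line_le n M hR1 ha0 ha W
  calc nsqV M (QvL n M (fun _ _ _ _ => (1 : E →L[ℂ] E)) W)
      = nsqV M (QvL n M (lineT n M (fun _ => (1 : E →L[ℂ] E)) R) W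
          + (QvL n M (fun _ _ _ _ => (1 : E →L[ℂ] E)) W - QvL n M (lineT n M (fun _ => (1 : E →L[ℂ] E)) R) W)) := by rw [add_sub_cancel]
    _ ≤ _ := nsqV_add_le M _ _
    _ ≤ _ := by nlinarith [h]

end Average


end Summit.QuantumFields.BalabanUV.T4Continuum.RegularGaugePerturbation

end
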